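import Mathlib
import HarnessLib
import Literature.Combinatorics.Additive.StepBeyondKempermanSubcaseOne
import Literature.Combinatorics.Additive.StepBeyondKempermanSubcaseTwo
import Literature.Combinatorics.Additive.StepBeyondKempermanSubcaseThree
import Literature.Combinatorics.Additive.StepBeyondKempermanMinThree

/-!
# Grynkiewicz 2009, Theorem 4.1 (first part) for finite `G` — the second stage of the induction, modulo Subcase 4

[cite: Grynkiewicz2009, Thm 4.1; §6 CASE I (pp. 23–34)] [tag: critical-pair] [tag: inverse-theorem]

Topic `Literature/Combinatorics/Additive`.  Cell `mm-stpp` (D-0046), seat `mm-stpp-lit` (gen 25); the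
port of D. J. Grynkiewicz, *A step beyond Kemperman's structure theorem*, Mathematika **55** (2009)
67–114 continued.  STAGE 2 of the re-cut induction (`StepBeyondKempermanMinThree.lean` is stage 1,
`min(|A|, |B|) ≤ 3`): the printed induction of CASE I «assuming the theorem true for non-quasi-periodic,
generating A′ and B′ with min{|A′|, |B′|} < min{|A|, |B|}, or min{|A′|, |B′|} = min{|A|, |B|} and
|A′| + |B′| > |A| + |B|» (print p. 29), run over the CORE PAIRS of a fixed finite `G` (`0 ∈ A ∩ B`,
`|A|, |B| ≥ 3`, `|A + B| = |A| + |B|`, `A + B` aperiodic, `d⊆(A + B, 𝒫) ≥ 2`, `(A, B)` and `(B, A)`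
non-extendible, `A`, `B` not quasi-periodic, `⟨A⟩ = ⟨B⟩ = G`), with the one sub-case not yet in the tree —
SUBCASE 4 (`|B(e)| = 2`, print pp. 32–34) — carried as the explicit hypothesis `four` (its exact printed
standing data: Claims 4, 5, 8, 10, (45)–(51), the maximal `e` with `|B(e)| = 2` and `A(e) + B(e)`
aperiodic, and the induction hypothesis in the printed form).

* `Grynkiewicz2009.subcaseTwo_false` — SUBCASE 2 (`|B(e)| ≥ 3`, `A(e) + B(e)` aperiodic) assembled:
  `subcaseTwo_reduction` (¶1–3 set-up) + the induction hypothesis for `(A(e), B(e))` +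
  `subcaseTwo_false_of_conclusion` (¶3).
* `Grynkiewicz2009.core_step` — the body of CASE I for a core pair with `|A| ≥ |B| ≥ 4` (print pp. 28–34):
  Claim 5 (`claim5_conclusion`), (47) (`two_le_subsetDist_isQuasiPeriodic_or_seventeen`), (48)
  (`three_le_card_sdiff_compl_or_seventeen(_right)`), (49) (`two_le_subsetDist_compl_isQuasiPeriodic`),
  (50) (`seventeen_of_subsetDist_quasiProgression_le_one(_right)`), (51)
  (`two_le_subsetDist_compl_quasiProgression`), Claim 8 (`card_layerWith_le_one_and_or_seventeen`), (45)–(46)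
  (`not_isQuasiPeriodic_add_and_compl`), Claim 10 (`claim10`, its induction hypothesis for
  `(−B, \overline{A + B})` with `|\overline{A + B}| = 3` supplied by stage 1), the maximal `e`
  (`exists_max_eTransform`), and the four sub-cases: Subcase 1 (`subcaseOne_seventeen`), Subcase 3
  (`subcaseThree_false`), Subcase 2 (`subcaseTwo_false`), Subcase 4 (`four`).
* `Grynkiewicz2009.core_conclusion` — the lexicographic induction on `(min(|A|, |B|), |G| − |A| − |B|)` over
  core pairs of `G` (stage 1 for `min ≤ 3`, `core_step` / its mirror image otherwise).
* `Grynkiewicz2009.conclusion_of_subcaseFour` — THEOREM 4.1 (first part) for finite `G`, for ALL nonempty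
  `A, B` with `|A + B| = |A| + |B|` and `A + B` aperiodic, modulo Subcase 4 in the subgroups of `G`
  (Claims 1–4: `conclusion_of_core_of_class` with the trivial class).

WHAT THIS FILE IS NOT: Subcase 4 itself (to be `subcaseFour_false`, discharging `four`); CASE II (infinite
`G`); no new definitions, no named facts.

## References
* D. J. Grynkiewicz, *A step beyond Kemperman's structure theorem*, Mathematika 55 (2009) 67–114,
  doi:10.1112/S0025579300000966; Thm 4.1 (p. 10), §6 CASE I pp. 23–34 (held
  `paper:doi-10-1112-s0025579300000966`; arXiv:0710.1041 pp. 20–29) [cite: Grynkiewicz2009, Thm 4.1].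
-/

namespace Literature.Combinatorics.Additive

open Finset
open scoped Pointwise

universe u

variable {G : Type u} [AddCommGroup G] [DecidableEq G]

namespace Grynkiewicz2009

/-- In `ℕ∞`: not `≥ 2` means `≤ 1`. [folklore] -/
private theorem le_one_of_not_two_le₄ {x : ℕ∞} (h : ¬ 2 ≤ x) : x ≤ 1 := by
  by_contra h1
  exact h (by
    have := Order.add_one_le_of_lt (not_le.1 h1)
    rwa [one_add_one_eq_two] at this)

/-! ### Subcase 2 assembled -/

/-- **§6 Subcase 2** (print p. 31): `|B(e)| ≥ 3` and `A(e) + B(e)` aperiodic is impossible, given the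
theorem for the core pairs `(A′, B′)` of `G` with `min(|A′|, |B′|) < |B| = min(|A|, |B|)` (applied to the
translate of `(A(e), B(e))` furnished by `subcaseTwo_reduction`; the contradiction is
`subcaseTwo_false_of_conclusion`). [cite: Grynkiewicz2009, §6 Subcase 2 (p. 31)] -/
theorem subcaseTwo_false [Fintype G] {A B : Finset G} {e : G}
    (h0A : (0 : G) ∈ A) (h0B : (0 : G) ∈ B) (hA4 : 4 ≤ #A)
    (hAB : #(A + B) = #A + #B) (haperAB : (A + B).addStab = {0})
    (hP3 : ∀ P : Finset G, A + B ⊆ P → P.addStab ≠ {0} → 3 ≤ #(P \ (A + B)))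
    (hneA : IsNonExtendible A B) (hneB : IsNonExtendible B A)
    (hgenA : AddSubgroup.closure (A : Set G) = ⊤) (hAqp : ¬ IsQuasiPeriodic A)
    (hC4 : 4 ≤ #(A + B)ᶜ)
    (h49 : 2 ≤ subsetDist (A + B)ᶜ {P | IsQuasiPeriodic P})
    (h51 : ∀ d : G, d ≠ 0 → 2 ≤ subsetDist (A + B)ᶜ {P | IsQuasiProgression d P})
    (hY3 : 3 ≤ #((e +ᵥ B) ∩ A)) (hlt : #((e +ᵥ B) ∩ A) < #B)
    (haper : (((e +ᵥ B) ∪ A) + ((e +ᵥ B) ∩ A)).addStab = {0})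
    (ih : ∀ X Y : Finset G, (0 : G) ∈ X → (0 : G) ∈ Y → 3 ≤ #X → 3 ≤ #Y → #(X + Y) = #X + #Y →
      (X + Y).addStab = {0} →
      (∀ P : Finset G, X + Y ⊆ P → P.addStab ≠ {0} → 2 ≤ #(P \ (X + Y))) →
      IsNonExtendible X Y → IsNonExtendible Y X → ¬ IsQuasiPeriodic X → ¬ IsQuasiPeriodic Y →
      AddSubgroup.closure (X : Set G) = ⊤ → AddSubgroup.closure (Y : Set G) = ⊤ →
      min #X #Y < #B →
      ((∃ α β : G, #(insert α X + insert β Y) + 1 = #(insert α X) + #(insert β Y)) ∨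
        ∃ (K : AddSubgroup G) (X₁ X₀ Y₁ Y₀ : Finset G), IsGrynkiewiczDecomp K X Y X₁ X₀ Y₁ Y₀)) :
    False := by
  obtain ⟨X, Y, h0X, h0Y, hcX, hcY, hXY, hP3', hneX, hneY, hgenX, hXqp, hgenY, hYqp, hcC, h49', h51'⟩ :=
    subcaseTwo_reduction h0A h0B (by omega) hAB haperAB hP3 hneA hneB hgenA hAqp (by omega) h49 h51 hY3
      haper
  have hX4 : 4 ≤ #X := by
    rw [hcX]; exact hA4.trans (card_le_card subset_union_right)
  have hY3' : 3 ≤ #Y := by rw [hcY]; exact hY3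
  have haperXY : (X + Y).addStab = {0} := by
    by_contra h
    have := hP3' (X + Y) Subset.rfl h
    rw [Finset.sdiff_self, card_empty] at this
    omega
  refine subcaseTwo_false_of_conclusion h0X h0Y hX4 hY3' hXY hP3' hneX hneY hgenX hXqp hgenY hYqp
    (by rw [hcC]; exact hC4) h49' h51' ?_
  exact ih X Y h0X h0Y (by omega) hY3' hXY haperXY (fun P hP hPs => by have := hP3' P hP hPs; omega)
    hneX hneY hXqp hYqp hgenX hgenY (lt_of_le_of_lt (Nat.min_le_right _ _) (by rw [hcY]; exact hlt))

/-! ### The body of CASE I for a core pair with `|A| ≥ |B| ≥ 4` -/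

/-- **CASE I for a core pair with `|A| ≥ |B| ≥ 4`** (print pp. 28–34), GIVEN the theorem for the core
pairs `(X, Y)` of `G` with `min(|X|, |Y|) < |B|`, or `min(|X|, |Y|) = |B|` and `|X| + |Y| > |A| + |B|`
(the printed induction hypothesis, p. 29), and GIVEN Subcase 4 (`four`).  Claim 5; (47); (48); (49);
(50); (51); Claim 8; (45)–(46); Claim 10 (the theorem for `(−B, \overline{A + B})` when
`|\overline{A + B}| = 3` is stage 1, `conclusion_of_min_card_le_three`); the maximal `e`
(`exists_max_eTransform`); Subcase 1 (`subcaseOne_seventeen`), and for `A(e) + B(e)` aperiodic: `|B(e)| = 1`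
Subcase 3 (`subcaseThree_false`), `|B(e)| = 2` Subcase 4 (`four`), `|B(e)| ≥ 3` Subcase 2
(`subcaseTwo_false`). [cite: Grynkiewicz2009, §6 CASE I (pp. 28–34)] -/
theorem core_step [Fintype G] {A B : Finset G}
    (four : ∀ (A B : Finset G) (e : G), (0 : G) ∈ A → (0 : G) ∈ B → #B ≤ #A → 4 ≤ #B →
        #(A + B) = #A + #B → (A + B).addStab = {0} →
        (∀ P : Finset G, A + B ⊆ P → P.addStab ≠ {0} → 3 ≤ #(P \ (A + B))) →
        IsNonExtendible A B → IsNonExtendible B A → ¬ IsQuasiPeriodic A → ¬ IsQuasiPeriodic B →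
        AddSubgroup.closure (A : Set G) = ⊤ → AddSubgroup.closure (B : Set G) = ⊤ →
        2 ≤ subsetDist A {P | IsQuasiPeriodic P} → 2 ≤ subsetDist B {P | IsQuasiPeriodic P} →
        (∀ P : Finset G, Aᶜ ⊆ P → P.addStab ≠ {0} → 3 ≤ #(P \ Aᶜ)) →
        (∀ P : Finset G, Bᶜ ⊆ P → P.addStab ≠ {0} → 3 ≤ #(P \ Bᶜ)) →
        2 ≤ subsetDist (A + B)ᶜ {P | IsQuasiPeriodic P} →
        (∀ d : G, d ≠ 0 → 2 ≤ subsetDist A {P | IsQuasiProgression d P}) →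
        (∀ d : G, d ≠ 0 → 2 ≤ subsetDist B {P | IsQuasiProgression d P}) →
        (∀ d : G, d ≠ 0 → 2 ≤ subsetDist (A + B)ᶜ {P | IsQuasiProgression d P}) →
        (∀ b ∈ B, #(layerWith A B 1 {b}) ≤ 1) → (∀ a ∈ A, #(layerWith B A 1 {a}) ≤ 1) →
        4 ≤ #(A + B)ᶜ →
        e ∈ A - B → #((e +ᵥ B) ∩ A) = 2 →
        (∀ e' ∈ A - B, #((e' +ᵥ B) ∩ A) < #B → #((e' +ᵥ B) ∩ A) ≤ #((e +ᵥ B) ∩ A)) →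
        (((e +ᵥ B) ∪ A) + ((e +ᵥ B) ∩ A)).addStab = {0} →
        (∀ X Y : Finset G, (0 : G) ∈ X → (0 : G) ∈ Y → 3 ≤ #X → 3 ≤ #Y → #(X + Y) = #X + #Y →
          (X + Y).addStab = {0} →
          (∀ P : Finset G, X + Y ⊆ P → P.addStab ≠ {0} → 2 ≤ #(P \ (X + Y))) →
          IsNonExtendible X Y → IsNonExtendible Y X → ¬ IsQuasiPeriodic X → ¬ IsQuasiPeriodic Y →
          AddSubgroup.closure (X : Set G) = ⊤ → AddSubgroup.closure (Y : Set G) = ⊤ →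
          (min #X #Y < #B ∨ (min #X #Y = #B ∧ #A + #B < #X + #Y)) →
          ((∃ α β : G, #(insert α X + insert β Y) + 1 = #(insert α X) + #(insert β Y)) ∨
            ∃ (K : AddSubgroup G) (X₁ X₀ Y₁ Y₀ : Finset G), IsGrynkiewiczDecomp K X Y X₁ X₀ Y₁ Y₀)) →
        False)
    (IH : (∀ X Y : Finset G, (0 : G) ∈ X → (0 : G) ∈ Y → 3 ≤ #X → 3 ≤ #Y → #(X + Y) = #X + #Y →
        (X + Y).addStab = {0} →
        (∀ P : Finset G, X + Y ⊆ P → P.addStab ≠ {0} → 2 ≤ #(P \ (X + Y))) →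
        IsNonExtendible X Y → IsNonExtendible Y X → ¬ IsQuasiPeriodic X → ¬ IsQuasiPeriodic Y →
        AddSubgroup.closure (X : Set G) = ⊤ → AddSubgroup.closure (Y : Set G) = ⊤ →
        (min #X #Y < #B ∨ (min #X #Y = #B ∧ #A + #B < #X + #Y)) →
        ((∃ α β : G, #(insert α X + insert β Y) + 1 = #(insert α X) + #(insert β Y)) ∨
          ∃ (K : AddSubgroup G) (X₁ X₀ Y₁ Y₀ : Finset G), IsGrynkiewiczDecomp K X Y X₁ X₀ Y₁ Y₀)))
    (h0A : (0 : G) ∈ A) (h0B : (0 : G) ∈ B) (hBA : #B ≤ #A) (hB4 : 4 ≤ #B)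
    (hAB : #(A + B) = #A + #B) (haper : (A + B).addStab = {0})
    (hP2 : ∀ P : Finset G, A + B ⊆ P → P.addStab ≠ {0} → 2 ≤ #(P \ (A + B)))
    (hneA : IsNonExtendible A B) (hneB : IsNonExtendible B A)
    (hAqp : ¬ IsQuasiPeriodic A) (hBqp : ¬ IsQuasiPeriodic B)
    (hgenA : AddSubgroup.closure (A : Set G) = ⊤) (hgenB : AddSubgroup.closure (B : Set G) = ⊤) :
    (∃ α β : G, #(insert α A + insert β B) + 1 = #(insert α A) + #(insert β B)) ∨
      ∃ (K : AddSubgroup G) (A₁ A₀ B₁ B₀ : Finset G), IsGrynkiewiczDecomp K A B A₁ A₀ B₁ B₀ := by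
  classical
  have hA3 : 3 ≤ #A := by omega
  have hB3 : 3 ≤ #B := by omega
  have hA4 : 4 ≤ #A := by omega
  have hAne : A.Nonempty := ⟨0, h0A⟩
  have hBne : B.Nonempty := ⟨0, h0B⟩
  -- Claim 5
  by_cases hP3 : ∀ P : Finset G, A + B ⊆ P → P.addStab ≠ {0} → 3 ≤ #(P \ (A + B))
  swap
  · push Not at hP3
    obtain ⟨P, h1, h2, h3⟩ := hP3
    exact claim5_conclusion h0A h0B hA3 hAB haper hP2 hneA hneB hAqp hBqp hgenA hgenB
      ⟨P, h1, h2, by omega⟩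
  have hC3 : 3 ≤ #(A + B)ᶜ := three_le_card_compl_of_forall (by omega) hP3
  -- (47)
  rcases two_le_subsetDist_isQuasiPeriodic_or_seventeen hA3 hB3 (Or.inr hB4) h0A h0B hAB hP3 hneA hneB
    hgenA hgenB hAqp hBqp with ⟨h47A, h47B⟩ | h17
  swap
  · exact Or.inl h17
  -- (48)
  rcases three_le_card_sdiff_compl_or_seventeen hA3 hB3 h0A h0B hAB hP3 hneA hneB hgenA hAqp with
    h48A | h17
  swap
  · exact Or.inl h17
  rcases three_le_card_sdiff_compl_or_seventeen_right hA3 hB3 h0A h0B hAB hP3 hneA hneB hgenB hBqp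
    with h48B | h17
  swap
  · exact Or.inl h17
  -- (49)
  have h49 := two_le_subsetDist_compl_isQuasiPeriodic h0A h0B hA3 hB4 hC3 hAB haper h48A hneA hneB
    hgenA hAqp h47B
  have h33 : ¬ (#A = 3 ∧ #(A + B)ᶜ = 3) := fun h => by omega
  -- (50)
  by_cases h50A : ∀ d : G, d ≠ 0 → 2 ≤ subsetDist A {P | IsQuasiProgression d P}
  swap
  · push Not at h50A
    obtain ⟨d, hd, hlt⟩ := h50A
    exact Or.inl (seventeen_of_subsetDist_quasiProgression_le_one hA3 hB3 h0A h0B hAB hP3 hneA hneB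
      hgenA h47A hd (le_one_of_not_two_le₄ (not_le.2 hlt)) fun h3 hC => h33 ⟨h3, hC⟩)
  by_cases h50B : ∀ d : G, d ≠ 0 → 2 ≤ subsetDist B {P | IsQuasiProgression d P}
  swap
  · push Not at h50B
    obtain ⟨d, hd, hlt⟩ := h50B
    exact Or.inl (seventeen_of_subsetDist_quasiProgression_le_one_right hA3 hB3 h0A h0B hAB hP3 hneA
      hneB hgenB h47B hd (le_one_of_not_two_le₄ (not_le.2 hlt)) fun h3 => absurd h3 (by omega))
  -- (51)
  have h51 : ∀ d : G, d ≠ 0 → 2 ≤ subsetDist (A + B)ᶜ {P | IsQuasiProgression d P} :=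
    fun d hd => two_le_subsetDist_compl_quasiProgression h0A h0B hA3 hB3 hC3 hAB haper h48A hneA hneB
      hgenA hAqp h47B h50B h49 (fun hC h3 => h33 ⟨h3, hC⟩) hd
  -- Claim 8
  rcases card_layerWith_le_one_and_or_seventeen h0A h0B hA3 hB3 hAB haper hneA hneB hgenA hgenB hAqp
    hBqp with ⟨hN1B, hN1A⟩ | h17
  swap
  · exact Or.inl h17
  -- (45)
  have h45 := (not_isQuasiPeriodic_add_and_compl hA3 hC3 h0A h0B hAB haper hneA hneB hgenA hAqp).1
  -- Claim 10 (its induction hypothesis, for `|\overline{A + B}| = 3`, is stage 1)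
  have hstA : A.addStab = {0} := by
    by_contra h
    exact hAqp (((isPeriodic_iff_addStab_ne hAne).2 h).isQuasiPeriodic hAne)
  have hC4 : 4 ≤ #(A + B)ᶜ := by
    by_contra hlt
    have hc3 : #(A + B)ᶜ = 3 := by omega
    refine hlt (claim10 h0B hA4 hB4 hAB hC3 hneA hstA hgenB h47B h50B fun hcrit hap => ?_)
    exact conclusion_of_min_card_le_three ⟨0, by rw [mem_neg', neg_zero]; exact h0B⟩
      (card_pos.1 (by omega)) hcrit hap (by rw [hc3]; exact Nat.min_le_right _ _)
  -- the maximal `e` (print p. 29)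
  have hAper : ¬ IsPeriodic A := fun h => hAqp (h.isQuasiPeriodic hAne)
  obtain ⟨e, he, hlt, hmax⟩ := exists_max_eTransform hAne hAper (by omega : 2 ≤ #B)
  have hYne : ((e +ᵥ B) ∩ A).Nonempty := eTransform_inter_nonempty_iff.2 he
  -- Subcase 1: `A(e) + B(e)` periodic
  by_cases hper : (((e +ᵥ B) ∪ A) + ((e +ᵥ B) ∩ A)).addStab ≠ {0}
  · exact Or.inl (subcaseOne_seventeen h0A h0B hA3 hB3 hAB hP3 hneA hneB hgenA hAqp h45 hYne hmax hper)
  rw [not_ne_iff] at hper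
  exfalso
  have hY1 : 0 < #((e +ᵥ B) ∩ A) := hYne.card_pos
  rcases (by omega : #((e +ᵥ B) ∩ A) = 1 ∨ #((e +ᵥ B) ∩ A) = 2 ∨ 3 ≤ #((e +ᵥ B) ∩ A)) with
    hY | hY | hY
  · -- Subcase 3: `|B(e)| = 1`
    refine subcaseThree_false hBA hB4 hAB (fun x hx => ?_) hAqp hN1A h45
    rw [inter_comm]
    by_cases hxAB : x ∈ A - B
    · have hxlt : #((x +ᵥ B) ∩ A) < #B := by
        by_contra hge
        apply hx
        have hle : #(x +ᵥ B) ≤ #((x +ᵥ B) ∩ A) := by rw [card_vadd_finset]; omega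
        have := eq_of_subset_of_card_le inter_subset_left hle
        rw [← this]; exact inter_subset_right
      have := hmax x hxAB hxlt
      omega
    · have h0 : ¬ ((x +ᵥ B) ∩ A).Nonempty := fun h => hxAB (eTransform_inter_nonempty_iff.1 h)
      rw [not_nonempty_iff_eq_empty] at h0
      rw [h0, card_empty]; omega
  · -- Subcase 4: `|B(e)| = 2`
    exact four A B e h0A h0B hBA hB4 hAB haper hP3 hneA hneB hAqp hBqp hgenA hgenB h47A h47B h48A h48B
      h49 h50A h50B h51 hN1B hN1A hC4 he hY hmax hper IH
  · -- Subcase 2: `|B(e)| ≥ 3`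
    exact subcaseTwo_false h0A h0B hA4 hAB haper hP3 hneA hneB hgenA hAqp hC4 h49 h51 hY hlt hper
      fun X Y h0X h0Y hX3 hY3 hXY haperXY hP2' hneX hneY hXqp hYqp hgenX hgenY hmin =>
        IH X Y h0X h0Y hX3 hY3 hXY haperXY hP2' hneX hneY hXqp hYqp hgenX hgenY (Or.inl hmin)

/-! ### The induction over core pairs -/

/-- **Theorem 4.1 (first part) for the core pairs of a finite `G`, modulo Subcase 4** — by the printed
lexicographic induction on `(min(|A|, |B|), |G| − |A| − |B|)` (p. 29: «we have already verified the base
of the induction when … min{|A|, |B|} ≤ 3» — stage 1, `conclusion_of_min_card_le_three`; the step is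
`core_step`, applied to `(A, B)` or `(B, A)` according as `|A| ≥ |B|` or not).
[cite: Grynkiewicz2009, Thm 4.1; §6 CASE I (pp. 23–34)] -/
theorem core_conclusion [Fintype G]
    (four : ∀ (A B : Finset G) (e : G), (0 : G) ∈ A → (0 : G) ∈ B → #B ≤ #A → 4 ≤ #B →
        #(A + B) = #A + #B → (A + B).addStab = {0} →
        (∀ P : Finset G, A + B ⊆ P → P.addStab ≠ {0} → 3 ≤ #(P \ (A + B))) →
        IsNonExtendible A B → IsNonExtendible B A → ¬ IsQuasiPeriodic A → ¬ IsQuasiPeriodic B →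
        AddSubgroup.closure (A : Set G) = ⊤ → AddSubgroup.closure (B : Set G) = ⊤ →
        2 ≤ subsetDist A {P | IsQuasiPeriodic P} → 2 ≤ subsetDist B {P | IsQuasiPeriodic P} →
        (∀ P : Finset G, Aᶜ ⊆ P → P.addStab ≠ {0} → 3 ≤ #(P \ Aᶜ)) →
        (∀ P : Finset G, Bᶜ ⊆ P → P.addStab ≠ {0} → 3 ≤ #(P \ Bᶜ)) →
        2 ≤ subsetDist (A + B)ᶜ {P | IsQuasiPeriodic P} →
        (∀ d : G, d ≠ 0 → 2 ≤ subsetDist A {P | IsQuasiProgression d P}) →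
        (∀ d : G, d ≠ 0 → 2 ≤ subsetDist B {P | IsQuasiProgression d P}) →
        (∀ d : G, d ≠ 0 → 2 ≤ subsetDist (A + B)ᶜ {P | IsQuasiProgression d P}) →
        (∀ b ∈ B, #(layerWith A B 1 {b}) ≤ 1) → (∀ a ∈ A, #(layerWith B A 1 {a}) ≤ 1) →
        4 ≤ #(A + B)ᶜ →
        e ∈ A - B → #((e +ᵥ B) ∩ A) = 2 →
        (∀ e' ∈ A - B, #((e' +ᵥ B) ∩ A) < #B → #((e' +ᵥ B) ∩ A) ≤ #((e +ᵥ B) ∩ A)) →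
        (((e +ᵥ B) ∪ A) + ((e +ᵥ B) ∩ A)).addStab = {0} →
        (∀ X Y : Finset G, (0 : G) ∈ X → (0 : G) ∈ Y → 3 ≤ #X → 3 ≤ #Y → #(X + Y) = #X + #Y →
          (X + Y).addStab = {0} →
          (∀ P : Finset G, X + Y ⊆ P → P.addStab ≠ {0} → 2 ≤ #(P \ (X + Y))) →
          IsNonExtendible X Y → IsNonExtendible Y X → ¬ IsQuasiPeriodic X → ¬ IsQuasiPeriodic Y →
          AddSubgroup.closure (X : Set G) = ⊤ → AddSubgroup.closure (Y : Set G) = ⊤ →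
          (min #X #Y < #B ∨ (min #X #Y = #B ∧ #A + #B < #X + #Y)) →
          ((∃ α β : G, #(insert α X + insert β Y) + 1 = #(insert α X) + #(insert β Y)) ∨
            ∃ (K : AddSubgroup G) (X₁ X₀ Y₁ Y₀ : Finset G), IsGrynkiewiczDecomp K X Y X₁ X₀ Y₁ Y₀)) →
        False)
    {A B : Finset G} (h0A : (0 : G) ∈ A) (h0B : (0 : G) ∈ B) (hA3 : 3 ≤ #A) (hB3 : 3 ≤ #B)
    (hAB : #(A + B) = #A + #B) (haper : (A + B).addStab = {0})
    (hP2 : ∀ P : Finset G, A + B ⊆ P → P.addStab ≠ {0} → 2 ≤ #(P \ (A + B)))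
    (hneA : IsNonExtendible A B) (hneB : IsNonExtendible B A)
    (hAqp : ¬ IsQuasiPeriodic A) (hBqp : ¬ IsQuasiPeriodic B)
    (hgenA : AddSubgroup.closure (A : Set G) = ⊤) (hgenB : AddSubgroup.closure (B : Set G) = ⊤) :
    (∃ α β : G, #(insert α A + insert β B) + 1 = #(insert α A) + #(insert β B)) ∨
      ∃ (K : AddSubgroup G) (A₁ A₀ B₁ B₀ : Finset G), IsGrynkiewiczDecomp K A B A₁ A₀ B₁ B₀ := by
  classical
  suffices key : ∀ m n : ℕ, ∀ A B : Finset G, min #A #B = m → Fintype.card G - (#A + #B) = n →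
      (0 : G) ∈ A → (0 : G) ∈ B → 3 ≤ #A → 3 ≤ #B → #(A + B) = #A + #B → (A + B).addStab = {0} →
      (∀ P : Finset G, A + B ⊆ P → P.addStab ≠ {0} → 2 ≤ #(P \ (A + B))) →
      IsNonExtendible A B → IsNonExtendible B A → ¬ IsQuasiPeriodic A → ¬ IsQuasiPeriodic B →
      AddSubgroup.closure (A : Set G) = ⊤ → AddSubgroup.closure (B : Set G) = ⊤ →
      ((∃ α β : G, #(insert α A + insert β B) + 1 = #(insert α A) + #(insert β B)) ∨
      ∃ (K : AddSubgroup G) (A₁ A₀ B₁ B₀ : Finset G), IsGrynkiewiczDecomp K A B A₁ A₀ B₁ B₀) from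
    key _ _ A B rfl rfl h0A h0B hA3 hB3 hAB haper hP2 hneA hneB hAqp hBqp hgenA hgenB
  intro m
  refine Nat.strong_induction_on m ?_
  intro m ihm n
  refine Nat.strong_induction_on n ?_
  intro n ihn A B hm hn h0A h0B hA3 hB3 hAB haper hP2 hneA hneB hAqp hBqp hgenA hgenB
  by_cases hmin : min #A #B ≤ 3
  · exact conclusion_of_min_card_le_three ⟨0, h0A⟩ ⟨0, h0B⟩ hAB haper hmin
  have IH : ∀ X Y : Finset G, (0 : G) ∈ X → (0 : G) ∈ Y → 3 ≤ #X → 3 ≤ #Y → #(X + Y) = #X + #Y →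
      (X + Y).addStab = {0} →
      (∀ P : Finset G, X + Y ⊆ P → P.addStab ≠ {0} → 2 ≤ #(P \ (X + Y))) →
      IsNonExtendible X Y → IsNonExtendible Y X → ¬ IsQuasiPeriodic X → ¬ IsQuasiPeriodic Y →
      AddSubgroup.closure (X : Set G) = ⊤ → AddSubgroup.closure (Y : Set G) = ⊤ →
      (min #X #Y < min #A #B ∨ (min #X #Y = min #A #B ∧ #A + #B < #X + #Y)) →
      ((∃ α β : G, #(insert α X + insert β Y) + 1 = #(insert α X) + #(insert β Y)) ∨
        ∃ (K : AddSubgroup G) (X₁ X₀ Y₁ Y₀ : Finset G), IsGrynkiewiczDecomp K X Y X₁ X₀ Y₁ Y₀) := by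
    intro X Y h0X h0Y hX3 hY3 hXY haperXY hP2' hneX hneY hXqp hYqp hgenX hgenY hlt
    rcases hlt with hlt | ⟨heq, hlt⟩
    · exact ihm _ (by omega) _ X Y rfl rfl h0X h0Y hX3 hY3 hXY haperXY hP2' hneX hneY hXqp hYqp hgenX
        hgenY
    · have hle : #X + #Y ≤ Fintype.card G := by rw [← hXY]; exact card_le_univ _
      exact ihn _ (by omega) X Y (by omega) rfl h0X h0Y hX3 hY3 hXY haperXY hP2' hneX hneY hXqp hYqp
        hgenX hgenY
  rcases le_total #B #A with hBA | hAB'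
  · have hminB : min #A #B = #B := Nat.min_eq_right hBA
    refine core_step four ?_ h0A h0B hBA (by omega) hAB haper hP2 hneA hneB hAqp hBqp hgenA hgenB
    intro X Y h0X h0Y hX3 hY3 hXY haperXY hP2' hneX hneY hXqp hYqp hgenX hgenY hlt
    exact IH X Y h0X h0Y hX3 hY3 hXY haperXY hP2' hneX hneY hXqp hYqp hgenX hgenY (by omega)
  · have hminA : min #A #B = #A := Nat.min_eq_left hAB'
    have hBAc : #(B + A) = #B + #A := by rw [add_comm, hAB, add_comm]
    have haper' : (B + A).addStab = {0} := by rwa [add_comm]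
    have hP2'' : ∀ P : Finset G, B + A ⊆ P → P.addStab ≠ {0} → 2 ≤ #(P \ (B + A)) := by
      rw [add_comm]; exact hP2
    refine conclusion_symm (core_step four ?_ h0B h0A hAB' (by omega) hBAc haper' hP2'' hneB hneA hBqp
      hAqp hgenB hgenA)
    intro X Y h0X h0Y hX3 hY3 hXY haperXY hP2' hneX hneY hXqp hYqp hgenX hgenY hlt
    exact IH X Y h0X h0Y hX3 hY3 hXY haperXY hP2' hneX hneY hXqp hYqp hgenX hgenY (by omega)

/-! ### Theorem 4.1 (first part) for finite `G`, modulo Subcase 4 -/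

/-- **Theorem 4.1 (first part) for finite `G`, modulo Subcase 4.**  Let `G` be a finite abelian group and
`A, B ⊆ G` nonempty with `|A + B| = |A| + |B|` and `A + B` aperiodic.  GIVEN Subcase 4 of the printed
proof in every subgroup of `G` (hypothesis `four`: for a core pair `(A, B)` of the subgroup with
`|A| ≥ |B| ≥ 4`, `|\overline{A + B}| ≥ 4`, all of (45)–(51) and Claim 8, a maximal `e ∈ A − B` with
`|B(e)| = 2` and `A(e) + B(e)` aperiodic, and the printed induction hypothesis, a contradiction), either
(17) holds for some `α, β`, or there are a nontrivial subgroup `H` and `A₁, A₀, B₁, B₀` with (i)–(iii) of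
Theorem 4.1 (`IsGrynkiewiczDecomp`).  Claims 1–4 (`conclusion_of_core_of_class`, trivial class) reduce to
the core pairs of the subgroups `⟨A⟩`, where `core_conclusion` applies.
[cite: Grynkiewicz2009, Thm 4.1; §6 CASE I (pp. 23–34)] -/
theorem conclusion_of_subcaseFour [Fintype G]
    (four : ∀ (G' : AddSubgroup G) [Fintype ↥G'],
      ∀ (A B : Finset ↥G') (e : ↥G'), (0 : ↥G') ∈ A → (0 : ↥G') ∈ B → #B ≤ #A → 4 ≤ #B →
        #(A + B) = #A + #B → (A + B).addStab = {0} →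
        (∀ P : Finset ↥G', A + B ⊆ P → P.addStab ≠ {0} → 3 ≤ #(P \ (A + B))) →
        IsNonExtendible A B → IsNonExtendible B A → ¬ IsQuasiPeriodic A → ¬ IsQuasiPeriodic B →
        AddSubgroup.closure (A : Set ↥G') = ⊤ → AddSubgroup.closure (B : Set ↥G') = ⊤ →
        2 ≤ subsetDist A {P | IsQuasiPeriodic P} → 2 ≤ subsetDist B {P | IsQuasiPeriodic P} →
        (∀ P : Finset ↥G', Aᶜ ⊆ P → P.addStab ≠ {0} → 3 ≤ #(P \ Aᶜ)) →
        (∀ P : Finset ↥G', Bᶜ ⊆ P → P.addStab ≠ {0} → 3 ≤ #(P \ Bᶜ)) →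
        2 ≤ subsetDist (A + B)ᶜ {P | IsQuasiPeriodic P} →
        (∀ d : ↥G', d ≠ 0 → 2 ≤ subsetDist A {P | IsQuasiProgression d P}) →
        (∀ d : ↥G', d ≠ 0 → 2 ≤ subsetDist B {P | IsQuasiProgression d P}) →
        (∀ d : ↥G', d ≠ 0 → 2 ≤ subsetDist (A + B)ᶜ {P | IsQuasiProgression d P}) →
        (∀ b ∈ B, #(layerWith A B 1 {b}) ≤ 1) → (∀ a ∈ A, #(layerWith B A 1 {a}) ≤ 1) →
        4 ≤ #(A + B)ᶜ →
        e ∈ A - B → #((e +ᵥ B) ∩ A) = 2 →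
        (∀ e' ∈ A - B, #((e' +ᵥ B) ∩ A) < #B → #((e' +ᵥ B) ∩ A) ≤ #((e +ᵥ B) ∩ A)) →
        (((e +ᵥ B) ∪ A) + ((e +ᵥ B) ∩ A)).addStab = {0} →
        (∀ X Y : Finset ↥G', (0 : ↥G') ∈ X → (0 : ↥G') ∈ Y → 3 ≤ #X → 3 ≤ #Y → #(X + Y) = #X + #Y →
          (X + Y).addStab = {0} →
          (∀ P : Finset ↥G', X + Y ⊆ P → P.addStab ≠ {0} → 2 ≤ #(P \ (X + Y))) →
          IsNonExtendible X Y → IsNonExtendible Y X → ¬ IsQuasiPeriodic X → ¬ IsQuasiPeriodic Y →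
          AddSubgroup.closure (X : Set ↥G') = ⊤ → AddSubgroup.closure (Y : Set ↥G') = ⊤ →
          (min #X #Y < #B ∨ (min #X #Y = #B ∧ #A + #B < #X + #Y)) →
          ((∃ α β : ↥G', #(insert α X + insert β Y) + 1 = #(insert α X) + #(insert β Y)) ∨
            ∃ (K : AddSubgroup ↥G') (X₁ X₀ Y₁ Y₀ : Finset ↥G'), IsGrynkiewiczDecomp K X Y X₁ X₀ Y₁ Y₀)) →
        False)
    {A B : Finset G} (hA : A.Nonempty) (hB : B.Nonempty) (hAB : #(A + B) = #A + #B)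
    (haper : (A + B).addStab = {0}) :
    (∃ α β : G, #(insert α A + insert β B) + 1 = #(insert α A) + #(insert β B)) ∨
      ∃ (K : AddSubgroup G) (A₁ A₀ B₁ B₀ : Finset G), IsGrynkiewiczDecomp K A B A₁ A₀ B₁ B₀ := by
  classical
  refine conclusion_of_core_of_class (fun _ _ => True) (fun _ _ _ => trivial) (fun _ => trivial) ?_
    trivial hA hB hAB haper
  intro G' A B _ h0A h0B hA3 hB3 hAB haper hP2 hneA hneB hAqp hBqp hgenA hgenB
  haveI : Fintype ↥G' := Fintype.ofFinite _
  exact core_conclusion (four G') h0A h0B hA3 hB3 hAB haper hP2 hneA hneB hAqp hBqp hgenA hgenB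

end Grynkiewicz2009

end Literature.Combinatorics.Additive
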